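import Summits.Ventures.PercRepro.RankLevelSetRuleQCell
import Summits.Ventures.PercRepro.RankLevelSetFrameQ

/-!
# PercRepro — THE END CASES OF (R̂) FOR EVERY `q`, `k`: `m = q` IN THE KERNEL (night-1, gen 14; dossier §23.8 STATUS, §23.8′)

The binomial inequality (R̂) `Φ(q+k, q) ≤ R̂(q, k, m)` (item C-044-(R̂), `RhatIneq`) at `m = q` — the member's complementary
basis meets `cl Z` in a basis of the flat, so no swap uses the free part — is proved here for EVERY `q ≥ 1`, `k ≥ 2`:
* `mhat_self_zero` — `m̂(q, q; 0, j) = 1` (the only swap inside `Z ∪ X_D` is the trivial one);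
* `sum_Ioo_choose` — `Σ_{0<j<k} C(k, j) = 2^k − 2`;
* `two_pow_sub_two_le_rhat_self` — `2^k − 2 ≤ R̂(q, k, q)` (the `a = 0` terms alone);
* `phiK_le_two_pow_sub_two` — `Φ(q+k, q) ≤ 2^k − 2` (by `phiK_succ_le_two_mul_add_two` from `Φ(q+1, q) = 0`);
* **`rhatCell_self`** — `Φ(q+k, q) ≤ R̂(q, k, q)`: (R̂) at `m = q` for all `q`, `k`.
(The dossier's paper proof goes through `Φ(q+k, q) ≤ Φ(k, 0) = 2^k − 2`; the route here needs only the landed doubling bound.)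
Axioms: standard.
-/

namespace PercRepro

open Finset

/-- `m̂(q, q; 0, j) = 1`: with `m = q` the free-part cap is `q − m = 0`, and with `a = 0` the flat part is empty. -/
lemma mhat_self_zero (q j : ℕ) : mhat q q 0 j = 1 := by
  simp [mhat]

/-- `Σ_{0 < j < k} C(k, j) = 2^k − 2` for `k ≥ 1` (the row sum `2^k` minus its two end terms). -/
lemma sum_Ioo_choose (k : ℕ) (hk : 1 ≤ k) :
    (∑ j ∈ Finset.Ioo 0 k, (k.choose j : ℚ)) = 2 ^ k - 2 := by
  have hrow : (∑ j ∈ Finset.range (k + 1), (k.choose j : ℚ)) = 2 ^ k := by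
    exact_mod_cast Nat.sum_range_choose k
  have hsplit : Finset.range (k + 1) = insert 0 (insert k (Finset.Ioo 0 k)) := by
    ext u
    simp only [Finset.mem_range, Finset.mem_insert, Finset.mem_Ioo]
    omega
  have h0 : (0 : ℕ) ∉ insert k (Finset.Ioo 0 k) := by
    simp only [Finset.mem_insert, Finset.mem_Ioo]
    omega
  have hk' : k ∉ Finset.Ioo 0 k := by simp
  rw [hsplit, Finset.sum_insert h0, Finset.sum_insert hk'] at hrow
  simp only [Nat.choose_zero_right, Nat.choose_self, Nat.cast_one] at hrow
  linarith

/-- The `a = 0` terms of `R̂(q, k, q)` alone give `Σ_{0<j<k} C(k, j) = 2^k − 2`; all other terms are nonnegative. -/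
lemma two_pow_sub_two_le_rhat_self (q k : ℕ) (hk : 1 ≤ k) : (2 : ℚ) ^ k - 2 ≤ rhat q k q := by
  rw [← sum_Ioo_choose k hk]
  unfold rhat
  apply Finset.sum_le_sum
  intro j _
  have h0 : (0 : ℕ) ∈ Finset.range (q + 1) := by simp
  calc (k.choose j : ℚ)
      = ((q.choose 0 * (q + k - q).choose j : ℕ) : ℚ) / (mhat q q 0 j : ℚ) := by
        simp [mhat_self_zero]
    _ ≤ ∑ a ∈ Finset.range (q + 1),
          ((q.choose a * (q + k - q).choose j : ℕ) : ℚ) / (mhat q q a j : ℚ) := by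
        apply Finset.single_le_sum (f := fun a =>
          ((q.choose a * (q + k - q).choose j : ℕ) : ℚ) / (mhat q q a j : ℚ)) _ h0
        intro a _
        exact div_nonneg (Nat.cast_nonneg _) (Nat.cast_nonneg _)

/-- `Φ(q + 1, q) = 0`: the index range `Ioo q (q+1)` is empty. -/
lemma phiK_succ_self' (q : ℕ) : phiK (q + 1) q = 0 := by
  unfold phiK
  have h : Finset.Ioo q (q + 1) = ∅ := by
    ext u
    constructor
    · intro hu
      rw [Finset.mem_Ioo] at hu
      omega
    · intro hu
      exact absurd hu (by simp)
  rw [h, Finset.sum_empty, zero_div]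

/-- `Φ(q + k, q) ≤ 2^k − 2` for `k ≥ 1`: from `Φ(q+1, q) = 0` by the doubling bound `Φ(p+1, q) ≤ 2Φ(p, q) + 2`. -/
lemma phiK_le_two_pow_sub_two (q k : ℕ) (hk : 1 ≤ k) : phiK (q + k) q ≤ (2 : ℚ) ^ k - 2 := by
  induction k with
  | zero => omega
  | succ k ih =>
    rcases Nat.eq_zero_or_pos k with hk0 | hkpos
    · subst hk0
      rw [phiK_succ_self' q]
      norm_num
    · have h1 := phiK_succ_le_two_mul_add_two (q + k) q (by omega)
      have h2 := ih hkpos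
      rw [show q + (k + 1) = q + k + 1 by omega]
      calc phiK (q + k + 1) q ≤ 2 * phiK (q + k) q + 2 := h1
        _ ≤ 2 * ((2 : ℚ) ^ k - 2) + 2 := by linarith
        _ = (2 : ℚ) ^ (k + 1) - 2 := by ring

/-- **(R̂) at `m = q` for every `q ≥ 1`, `k ≥ 2`** (the `m = q` case of item C-044-(R̂)): `Φ(q+k, q) ≤ R̂(q, k, q)`. -/
theorem rhatCell_self (q k : ℕ) (hk : 2 ≤ k) : phiK (q + k) q ≤ rhat q k q :=
  (phiK_le_two_pow_sub_two q k (by omega)).trans (two_pow_sub_two_le_rhat_self q k (by omega))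

end PercRepro
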